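import Literature.AlgebraicGeometry.Motives.MumfordTateGroupRealPointsSignedPolarFactorisation
import Literature.AlgebraicGeometry.HodgeTheory.BettiOneHodgeStructureModelIndependence
import HarnessLib

/-!
# `Ker ν = μ₂ · Hg(Hᵏ(X))`, `MT(Hᵏ(X))(ℂ) = ℂ^× · Hg(Hᵏ(X))(ℂ)`, `MT(Hᵏ(X))(ℝ) ∩ Z(C_ℝ) = ℝ^× · (Hg(Hᵏ(X))(ℝ) ∩ Z(C_ℝ))` and
# `[MT(Hᵏ(X))(L) : Hg(Hᵏ(X))(L)] = ∞` for EVERY smooth projective `X` and EVERY degree `k` (even degrees included)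
# (Carlson–Müller-Stach–Peters 15.2 Remark (ii); Green–Griffiths–Kerr §I.B; Deligne 1982 I proof of 3.6; Moonen (5.8); Voisin 7.1.2)

Family `hodge`, lane `lit-hodgefound` (Track 2 foundations library; Layers A2/A3), layer `Literature/AlgebraicGeometry/HodgeTheory`.  THEOREMS
ONLY (no definition, no named fact, no instance; D-0026 net debt `0`).  The Betti TRANSPORT of the seat's `Motives/HodgeGroupKernelMultiplierCharacterSign`
(g23-#1) and `Motives/MumfordTateGroupRealPointsSignedPolarFactorisation` (g23-#2) to the tree's geometric Hodge structures `Hᵏ(X) =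
BettiUniverse.hodge hHD hX k` of weight `k` on `Hᵏ(X(ℂ); ℚ)` (polarizable: `BettiUniverse.hodge_isPolarizable`, Voisin Thm. 6.32), for ALL degrees
`k` — the seat's g22-#10 `HodgeTheory/CMAbelianVarietyMumfordTateRealPointsProduct` §1 had ODD `k` only («NOT HERE: even `k`»).  Even degrees are
where the sign matters: `H²` of a K3 or abelian surface, `H^{2p}` carrying the Hodge classes.

THE PRINTS.  J. Carlson, S. Müller-Stach, C. Peters (2017) [CarlsonMullerStachPeters2017] §15.2 Remark (ii) after Def. 15.2.1 (p. 368) «`MT(h) = SMT(h) ·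
h∘w(𝐆_m)` … If the weight `k = 0` we have of course `MT(h) = SMT(h)` but otherwise … isogenous to `SMT(h) × G_m`»; Examples 15.2.4 (i).  M. Green,
P. Griffiths, M. Kerr (2012) [GreenGriffithsKerr2012] §I.B p. 35 «`M_φ̃` is the semi-direct product of its subgroups `M_φ` and `𝔾_{m,ℚ}`», §II.A p. 45.
P. Deligne (1982) [Deligne1982HodgeCycles] I proof of Prop. 3.6 (the compact real form defined by `ad C`; `G⁰ = Ker(G → 𝔾_m)`).  B. Moonen (2004)
[Moonen2004MT] (5.8).  C. Voisin [VoisinHodgeI2002] §7.1.2 / Thm. 6.32 (polarizability of `Hᵏ(X)`).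

THE OBJECTS (all the tree's / Mathlib's).  `X : SchemeOver ℂ`, `hX : IsSmoothProjective n X`, `hHD : exists_isReal_hodgeModel` (named-fact hypothesis
discharged in the tree); `Hᵏ(X) = BettiUniverse.hodge hHD hX k`, its points `MT(L)`, `Hg(L) ≤ GL(L ⊗ Hᵏ(X; ℚ))`, a polarization `ψ` with multiplier
`ν = ψ.multiplierChar L`, the real Weil operator `C_ℝ` and `Z(C_ℝ) = Subgroup.centralizer {C_ℝ}`, Deligne's form `B_ψ(a, c) = ψ_ℝ(C_ℝ a, c)`, the
homotheties `c · id = LinearEquiv.smulOfUnit c`, `ℝ^×_{>0} = Units.posSubgroup ℝ`, Mathlib's `Subgroup.relIndex` / `Subgroup.index`.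

WHAT IS PROVED (`Hᵏ(X) ≠ 0`; `L ⊇ ℚ` any field unless said otherwise).
* §1 every `k`: `mem_or_neg_mem_hodgeGroupBaseChange_hodge_of_multiplierChar_eq_one` (`ν(γ) = 1 ⟹ γ ∈ Hg ∨ −γ ∈ Hg`),
  `multiplierChar_hodge_eq_one_iff_mem_or_neg_mem`; `k ≠ 0`: `ker_multiplierChar_hodge_eq_subgroupOf_iff` (`Ker ν = Hg ⟺ −1 ∈ Hg`),
  `relIndex_hodgeGroupBaseChange_hodge_ker_multiplierChar_dvd_two` (`[Ker ν : Hg] ∣ 2`); `L` algebraically closed, every `k`: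
  **`exists_smulOfUnit_mul_mem_hodgeGroupBaseChange_hodge_of_isAlgClosed`** (`MT(Hᵏ(X))(L) = L^× · Hg(Hᵏ(X))(L)`),
  `mem_mumfordTateGroupBaseChange_hodge_iff_exists_smulOfUnit_mul_mem_of_isAlgClosed` (`k ≠ 0`); `index_hodgeGroupBaseChange_hodge_subgroupOf_eq_zero`
  (`k ≠ 0`: `[MT(L) : Hg(L)] = ∞`).
* §2 real points, every `k`: **`exists_smulOfUnit_mul_mem_hodgeGroupBaseChange_hodge_real_of_comm`** (`MT(ℝ) ∩ Z(C_ℝ) = ℝ^× · (Hg(ℝ) ∩ Z(C_ℝ))`),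
  `mem_inf_centralizer_hodge_iff_exists_smulOfUnit_mul_mem` (`k ≠ 0`), `forall_realForm_hodge_eq_iff_mem_or_neg_mem_of_comm`
  (`O(B_ψ) ∩ MT(ℝ) ∩ Z(C_ℝ) = μ₂ · (Hg(ℝ) ∩ Z(C_ℝ))`), the two shapes `nonempty_inf_centralizer_hodge_mulEquiv_posSubgroup_prod_of_neg_one_mem` /
  `nonempty_inf_centralizer_hodge_mulEquiv_units_prod_of_neg_one_not_mem` (`k ≠ 0`), and
  `existsUnique_smulOfUnit_mul_mem_hodgeGroupBaseChange_hodge_real_of_comm_of_neg_one_not_mem`.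

DEVIATIONS / SCOPE.  On points, Tannaka-free; which side of the dichotomy `−1 · id ∈ Hg(Hᵏ(X))(ℝ)` holds is left as a hypothesis (odd `k`: always,
the tree's `smulOfUnit_neg_one_mem_hodgeGroupBaseChange`).

## References
* [CarlsonMullerStachPeters2017] J. Carlson, S. Müller-Stach, C. Peters, *Period Mappings and Period Domains*, 2nd ed. (2017) — §15.2 Remark (ii)
  after Def. 15.2.1 (p. 368), Examples 15.2.4 (i) (p. 369).
* [GreenGriffithsKerr2012] M. Green, P. A. Griffiths, M. Kerr, *Mumford–Tate Groups and Domains* (2012) — §I.B p. 35, §II.A p. 45.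
* [Deligne1982HodgeCycles] P. Deligne, *Hodge cycles on abelian varieties*, in LNM 900 (1982) — I §3 proof of Prop. 3.6 (p. 25).
* [Moonen2004MT] B. Moonen, *An introduction to Mumford–Tate groups* (2004) — (4.8), (5.8).
* [VoisinHodgeI2002] C. Voisin, *Hodge Theory and Complex Algebraic Geometry I* (2002) — §7.1.2, Thm. 6.32.

## Provenance
Lane `lit-hodgefound` (Hodge path, Track 2), prover seat `lit-hodgefound-p29` (generation 23), self-proposed row g23-#3 (Betti sequel of g23-#1/#2).
-/

noncomputable section

open scoped TensorProduct
open CategoryTheory Module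

namespace Literature.AlgebraicGeometry.HodgeTheory

open Literature.AlgebraicGeometry.Motives
open Literature.AlgebraicGeometry.Motives.HodgeStructure

universe w

section SmoothProjective

variable [HodgeTensorFacts.{0, 0}] {n : ℕ} {X : SchemeOver ℂ} {k : ℕ} [Module.Finite ℚ (bettiCohomology X k)]

/-! ### §1 `Ker ν = μ₂ · Hg(Hᵏ(X))` and `MT(Hᵏ(X))(L) = L^× · Hg(Hᵏ(X))(L)`, every degree -/

/-- **`ν(γ) = 1 ⟹ γ ∈ Hg(Hᵏ(X))(L)` or `−γ ∈ Hg(Hᵏ(X))(L)`**, every smooth projective `X`, EVERY degree `k` (`Hᵏ(X) ≠ 0`), every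
polarization `ψ` of `Hᵏ(X)` and field `L ⊇ ℚ`. [cite: Moonen2004MT, (5.8)] [cite: CarlsonMullerStachPeters2017, §15.2 Remark (ii) after Definition 15.2.1 (p. 368)] -/
theorem mem_or_neg_mem_hodgeGroupBaseChange_hodge_of_multiplierChar_eq_one [Nontrivial (bettiCohomology X k)]
    (hHD : exists_isReal_hodgeModel) (hX : IsSmoothProjective n X) (L : Type w) [Field L] [Algebra ℚ L]
    (ψ : (BettiUniverse.hodge hHD hX k).Polarization)
    {γ : (L ⊗[ℚ] bettiCohomology X k) ≃ₗ[L] (L ⊗[ℚ] bettiCohomology X k)}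
    (hγ : γ ∈ (BettiUniverse.hodge hHD hX k).mumfordTateGroupBaseChange L) (hν : ψ.multiplierChar L ⟨γ, hγ⟩ = 1) :
    γ ∈ (BettiUniverse.hodge hHD hX k).hodgeGroupBaseChange L ∨
      LinearEquiv.smulOfUnit (-1) * γ ∈ (BettiUniverse.hodge hHD hX k).hodgeGroupBaseChange L :=
  ψ.mem_or_neg_mem_hodgeGroupBaseChange_of_multiplierChar_eq_one L hγ hν

/-- **`ν(γ) = 1 ⟺ γ ∈ Hg(Hᵏ(X))(L) ∨ −γ ∈ Hg(Hᵏ(X))(L)`** (`γ ∈ MT(Hᵏ(X))(L)`, every `k`). [cite: Moonen2004MT, (5.8)]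
[cite: CarlsonMullerStachPeters2017, §15.2 Remark (ii) after Definition 15.2.1 (p. 368)] -/
theorem multiplierChar_hodge_eq_one_iff_mem_or_neg_mem [Nontrivial (bettiCohomology X k)] (hHD : exists_isReal_hodgeModel)
    (hX : IsSmoothProjective n X) (L : Type w) [Field L] [Algebra ℚ L] (ψ : (BettiUniverse.hodge hHD hX k).Polarization)
    {γ : (L ⊗[ℚ] bettiCohomology X k) ≃ₗ[L] (L ⊗[ℚ] bettiCohomology X k)}
    (hγ : γ ∈ (BettiUniverse.hodge hHD hX k).mumfordTateGroupBaseChange L) :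
    ψ.multiplierChar L ⟨γ, hγ⟩ = 1 ↔
      γ ∈ (BettiUniverse.hodge hHD hX k).hodgeGroupBaseChange L ∨
        LinearEquiv.smulOfUnit (-1) * γ ∈ (BettiUniverse.hodge hHD hX k).hodgeGroupBaseChange L :=
  ψ.multiplierChar_eq_one_iff_mem_or_neg_mem L hγ

/-- **`Ker ν = Hg(Hᵏ(X))(L) ⟺ −1 · id ∈ Hg(Hᵏ(X))(L)`** (`k ≠ 0`; always true for odd `k`). [cite: Moonen2004MT, (5.8)]
[cite: CarlsonMullerStachPeters2017, §15.2 Examples 15.2.4] -/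
theorem ker_multiplierChar_hodge_eq_subgroupOf_iff [Nontrivial (bettiCohomology X k)] (hHD : exists_isReal_hodgeModel)
    (hX : IsSmoothProjective n X) (hk : k ≠ 0) (L : Type w) [Field L] [Algebra ℚ L] (ψ : (BettiUniverse.hodge hHD hX k).Polarization) :
    (ψ.multiplierChar L).ker = ((BettiUniverse.hodge hHD hX k).hodgeGroupBaseChange L).subgroupOf
        ((BettiUniverse.hodge hHD hX k).mumfordTateGroupBaseChange L) ↔
      LinearEquiv.smulOfUnit (-1) ∈ (BettiUniverse.hodge hHD hX k).hodgeGroupBaseChange L :=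
  ψ.ker_multiplierChar_eq_subgroupOf_iff L (Int.natCast_ne_zero.2 hk)

/-- **`[Ker ν : Hg(Hᵏ(X))(L)]` divides `2`** (`k ≠ 0`): Moonen's kernel exceeds the fixing-group Hodge group by at most the sign.
[cite: Moonen2004MT, (4.8) and (5.8)] [cite: CarlsonMullerStachPeters2017, §15.2 Remark (ii) after Definition 15.2.1 (p. 368)] -/
theorem relIndex_hodgeGroupBaseChange_hodge_ker_multiplierChar_dvd_two [Nontrivial (bettiCohomology X k)]
    (hHD : exists_isReal_hodgeModel) (hX : IsSmoothProjective n X) (hk : k ≠ 0) (L : Type w) [Field L] [Algebra ℚ L]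
    (ψ : (BettiUniverse.hodge hHD hX k).Polarization) :
    (((BettiUniverse.hodge hHD hX k).hodgeGroupBaseChange L).subgroupOf
        ((BettiUniverse.hodge hHD hX k).mumfordTateGroupBaseChange L)).relIndex (ψ.multiplierChar L).ker ∣ 2 :=
  ψ.relIndex_hodgeGroupBaseChange_ker_multiplierChar_dvd_two L (Int.natCast_ne_zero.2 hk)

/-- **`MT(Hᵏ(X))(L) = L^× · Hg(Hᵏ(X))(L)` over an algebraically closed field `L ⊇ ℚ` (e.g. `ℂ`), EVERY degree `k`** (`Hᵏ(X) ≠ 0`):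
`(c · id) γ ∈ Hg` for some `c ∈ L^×` — «`MT(h) = SMT(h) · h∘w(𝐆_m)`» on points. [cite: CarlsonMullerStachPeters2017, §15.2 Remark (ii) after Definition 15.2.1 (p. 368)]
[cite: GreenGriffithsKerr2012, §I.B p. 35 (semi-direct product remark)] [cite: VoisinHodgeI2002, §7.1.2 and Thm. 6.32] -/
theorem exists_smulOfUnit_mul_mem_hodgeGroupBaseChange_hodge_of_isAlgClosed [Nontrivial (bettiCohomology X k)]
    (hHD : exists_isReal_hodgeModel) (hX : IsSmoothProjective n X) (L : Type w) [Field L] [Algebra ℚ L] [IsAlgClosed L]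
    {γ : (L ⊗[ℚ] bettiCohomology X k) ≃ₗ[L] (L ⊗[ℚ] bettiCohomology X k)}
    (hγ : γ ∈ (BettiUniverse.hodge hHD hX k).mumfordTateGroupBaseChange L) :
    ∃ c : Lˣ, LinearEquiv.smulOfUnit c * γ ∈ (BettiUniverse.hodge hHD hX k).hodgeGroupBaseChange L :=
  exists_smulOfUnit_mul_mem_hodgeGroupBaseChange_of_isAlgClosed L (BettiUniverse.hodge_isPolarizable hHD hX k) hγ

/-- `γ ∈ MT(Hᵏ(X))(L) ⟺ (c · id) γ ∈ Hg(Hᵏ(X))(L)` for some `c` (`L` algebraically closed, `k ≠ 0`). [cite: GreenGriffithsKerr2012, §I.B p. 35 (semi-direct product remark)]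
[cite: CarlsonMullerStachPeters2017, §15.2 Remark (ii) after Definition 15.2.1 (p. 368)] -/
theorem mem_mumfordTateGroupBaseChange_hodge_iff_exists_smulOfUnit_mul_mem_of_isAlgClosed [Nontrivial (bettiCohomology X k)]
    (hHD : exists_isReal_hodgeModel) (hX : IsSmoothProjective n X) (hk : k ≠ 0) (L : Type w) [Field L] [Algebra ℚ L] [IsAlgClosed L]
    (γ : (L ⊗[ℚ] bettiCohomology X k) ≃ₗ[L] (L ⊗[ℚ] bettiCohomology X k)) :
    γ ∈ (BettiUniverse.hodge hHD hX k).mumfordTateGroupBaseChange L ↔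
      ∃ c : Lˣ, LinearEquiv.smulOfUnit c * γ ∈ (BettiUniverse.hodge hHD hX k).hodgeGroupBaseChange L :=
  mem_mumfordTateGroupBaseChange_iff_exists_smulOfUnit_mul_mem_of_isAlgClosed L (Int.natCast_ne_zero.2 hk)
    (BettiUniverse.hodge_isPolarizable hHD hX k) γ

/-- **`[MT(Hᵏ(X))(L) : Hg(Hᵏ(X))(L)] = ∞`** (`k ≠ 0`, every field `L ⊇ ℚ`; `Subgroup.index = 0`): the cosets of the homotheties `(m + 2) · id`
are pairwise distinct. [cite: CarlsonMullerStachPeters2017, §15.2 Remark (ii) after Definition 15.2.1 (p. 368) and Examples 15.2.4 (i)]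
[cite: GreenGriffithsKerr2012, §I.B p. 35 (semi-direct product remark)] -/
theorem index_hodgeGroupBaseChange_hodge_subgroupOf_eq_zero [Nontrivial (bettiCohomology X k)] (hHD : exists_isReal_hodgeModel)
    (hX : IsSmoothProjective n X) (hk : k ≠ 0) (L : Type w) [Field L] [Algebra ℚ L] :
    (((BettiUniverse.hodge hHD hX k).hodgeGroupBaseChange L).subgroupOf ((BettiUniverse.hodge hHD hX k).mumfordTateGroupBaseChange L)).index = 0 := by
  obtain ⟨ψ⟩ := BettiUniverse.hodge_isPolarizable hHD hX k
  exact index_hodgeGroupBaseChange_subgroupOf_eq_zero _ L ψ (Int.natCast_ne_zero.2 hk)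

/-! ### §2 Real points, every degree: `MT(Hᵏ(X))(ℝ) ∩ Z(C_ℝ) = ℝ^× · (Hg(Hᵏ(X))(ℝ) ∩ Z(C_ℝ))` -/

/-- **Every real point of `MT(Hᵏ(X))` commuting with the Weil operator is `t · γ₀`, `t ∈ ℝ^×`, `γ₀ ∈ Hg(Hᵏ(X))(ℝ)`** — EVERY degree `k`
(odd `k` with `t > 0`: the seat's g22-#4 `HodgeTheory/CMAbelianVarietyMumfordTateRealPointsPolarFactorisation`). [cite: GreenGriffithsKerr2012, §I.B p. 35 (semi-direct product remark) and §II.A p. 45]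
[cite: Deligne1982HodgeCycles, I §3 proof of Prop. 3.6 (p. 25)] [cite: VoisinHodgeI2002, §7.1.2 and Thm. 6.32] -/
theorem exists_smulOfUnit_mul_mem_hodgeGroupBaseChange_hodge_real_of_comm [Nontrivial (bettiCohomology X k)]
    (hHD : exists_isReal_hodgeModel) (hX : IsSmoothProjective n X)
    {γ : (ℝ ⊗[ℚ] bettiCohomology X k) ≃ₗ[ℝ] (ℝ ⊗[ℚ] bettiCohomology X k)}
    (hγ : γ ∈ (BettiUniverse.hodge hHD hX k).mumfordTateGroupBaseChange ℝ)
    (hC : ∀ a, γ ((BettiUniverse.hodge hHD hX k).realWeilOperator a) = (BettiUniverse.hodge hHD hX k).realWeilOperator (γ a)) :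
    ∃ c : ℝˣ, LinearEquiv.smulOfUnit c * γ ∈ (BettiUniverse.hodge hHD hX k).hodgeGroupBaseChange ℝ :=
  exists_smulOfUnit_mul_mem_hodgeGroupBaseChange_real_of_comm _ (BettiUniverse.hodge_isPolarizable hHD hX k) hγ hC

/-- **`MT(Hᵏ(X))(ℝ) ∩ Z(C_ℝ) = ℝ^× · (Hg(Hᵏ(X))(ℝ) ∩ Z(C_ℝ))`** as an equivalence (`k ≠ 0`). [cite: GreenGriffithsKerr2012, §I.B p. 35 (semi-direct product remark) and §II.A p. 45]
[cite: CarlsonMullerStachPeters2017, §15.2 Remark (ii) after Definition 15.2.1 (p. 368)] -/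
theorem mem_inf_centralizer_hodge_iff_exists_smulOfUnit_mul_mem [Nontrivial (bettiCohomology X k)] (hHD : exists_isReal_hodgeModel)
    (hX : IsSmoothProjective n X) (hk : k ≠ 0) (γ : (ℝ ⊗[ℚ] bettiCohomology X k) ≃ₗ[ℝ] (ℝ ⊗[ℚ] bettiCohomology X k)) :
    γ ∈ (BettiUniverse.hodge hHD hX k).mumfordTateGroupBaseChange ℝ ⊓ Subgroup.centralizer {(BettiUniverse.hodge hHD hX k).realWeilOperator} ↔
      ∃ c : ℝˣ, LinearEquiv.smulOfUnit c * γ ∈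
        (BettiUniverse.hodge hHD hX k).hodgeGroupBaseChange ℝ ⊓ Subgroup.centralizer {(BettiUniverse.hodge hHD hX k).realWeilOperator} :=
  mem_inf_centralizer_realWeilOperator_iff_exists_smulOfUnit_mul_mem _ (Int.natCast_ne_zero.2 hk) (BettiUniverse.hodge_isPolarizable hHD hX k) γ

/-- **`O(B_ψ) ∩ MT(Hᵏ(X))(ℝ) ∩ Z(C_ℝ) = μ₂ · (Hg(Hᵏ(X))(ℝ) ∩ Z(C_ℝ))`**, every `k`: a real point of `MT(Hᵏ(X))` commuting with `C_ℝ` is an isometry of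
Deligne's form `B_ψ(a, c) = ψ_ℝ(C_ℝ a, c)` iff `±` it lies in the Hodge group. [cite: Deligne1982HodgeCycles, I §3 proof of Prop. 3.6 (p. 25)]
[cite: Moonen2004MT, (5.8)] [cite: GreenGriffithsKerr2012, §II.A p. 45] -/
theorem forall_realForm_hodge_eq_iff_mem_or_neg_mem_of_comm [Nontrivial (bettiCohomology X k)] (hHD : exists_isReal_hodgeModel)
    (hX : IsSmoothProjective n X) (ψ : (BettiUniverse.hodge hHD hX k).Polarization)
    {γ : (ℝ ⊗[ℚ] bettiCohomology X k) ≃ₗ[ℝ] (ℝ ⊗[ℚ] bettiCohomology X k)}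
    (hγ : γ ∈ (BettiUniverse.hodge hHD hX k).mumfordTateGroupBaseChange ℝ)
    (hC : ∀ a, γ ((BettiUniverse.hodge hHD hX k).realWeilOperator a) = (BettiUniverse.hodge hHD hX k).realWeilOperator (γ a)) :
    (∀ a c, ψ.form.baseChange ℝ ((BettiUniverse.hodge hHD hX k).realWeilOperator (γ a)) (γ c) =
        ψ.form.baseChange ℝ ((BettiUniverse.hodge hHD hX k).realWeilOperator a) c) ↔
      γ ∈ (BettiUniverse.hodge hHD hX k).hodgeGroupBaseChange ℝ ∨
        LinearEquiv.smulOfUnit (-1) * γ ∈ (BettiUniverse.hodge hHD hX k).hodgeGroupBaseChange ℝ :=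
  ψ.forall_realForm_eq_iff_mem_or_neg_mem_of_comm _ hγ hC

/-- **`MT(Hᵏ(X))(ℝ) ∩ Z(C_ℝ) ≃* ℝ^×_{>0} × (Hg(Hᵏ(X))(ℝ) ∩ Z(C_ℝ))` when `−1 · id ∈ Hg(Hᵏ(X))(ℝ)`** (`k ≠ 0`; odd `k`: g22-#10 §1).
[cite: GreenGriffithsKerr2012, §I.B p. 35 (semi-direct product remark) and §II.A p. 45] [cite: CarlsonMullerStachPeters2017, §15.2 Remark (ii) after Definition 15.2.1 (p. 368)] -/
theorem nonempty_inf_centralizer_hodge_mulEquiv_posSubgroup_prod_of_neg_one_mem [Nontrivial (bettiCohomology X k)]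
    (hHD : exists_isReal_hodgeModel) (hX : IsSmoothProjective n X) (hk : k ≠ 0)
    (h1 : LinearEquiv.smulOfUnit (-1) ∈ (BettiUniverse.hodge hHD hX k).hodgeGroupBaseChange ℝ) :
    Nonempty (↥((BettiUniverse.hodge hHD hX k).mumfordTateGroupBaseChange ℝ ⊓
        Subgroup.centralizer {(BettiUniverse.hodge hHD hX k).realWeilOperator}) ≃*
      Units.posSubgroup ℝ × ↥((BettiUniverse.hodge hHD hX k).hodgeGroupBaseChange ℝ ⊓
        Subgroup.centralizer {(BettiUniverse.hodge hHD hX k).realWeilOperator})) :=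
  nonempty_inf_centralizer_mulEquiv_posSubgroup_prod_of_neg_one_mem _ (Int.natCast_ne_zero.2 hk)
    (BettiUniverse.hodge_isPolarizable hHD hX k) h1

/-- **`MT(Hᵏ(X))(ℝ) ∩ Z(C_ℝ) ≃* ℝ^× × (Hg(Hᵏ(X))(ℝ) ∩ Z(C_ℝ))` when `−1 · id ∉ Hg(Hᵏ(X))(ℝ)`** (`k ≠ 0`).
[cite: GreenGriffithsKerr2012, §I.B p. 35 (semi-direct product remark) and §II.A p. 45] [cite: CarlsonMullerStachPeters2017, §15.2 Remark (ii) after Definition 15.2.1 (p. 368) and Examples 15.2.4 (i)] -/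
theorem nonempty_inf_centralizer_hodge_mulEquiv_units_prod_of_neg_one_not_mem [Nontrivial (bettiCohomology X k)]
    (hHD : exists_isReal_hodgeModel) (hX : IsSmoothProjective n X) (hk : k ≠ 0)
    (h1 : LinearEquiv.smulOfUnit (-1) ∉ (BettiUniverse.hodge hHD hX k).hodgeGroupBaseChange ℝ) :
    Nonempty (↥((BettiUniverse.hodge hHD hX k).mumfordTateGroupBaseChange ℝ ⊓
        Subgroup.centralizer {(BettiUniverse.hodge hHD hX k).realWeilOperator}) ≃*
      ℝˣ × ↥((BettiUniverse.hodge hHD hX k).hodgeGroupBaseChange ℝ ⊓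
        Subgroup.centralizer {(BettiUniverse.hodge hHD hX k).realWeilOperator})) :=
  nonempty_inf_centralizer_mulEquiv_units_prod_of_neg_one_not_mem _ (Int.natCast_ne_zero.2 hk)
    (BettiUniverse.hodge_isPolarizable hHD hX k) h1

/-- **Uniqueness of the real scalar when `−1 · id ∉ Hg(Hᵏ(X))(ℝ)`** (every `k`, `ψ` a polarization): exactly one `c ∈ ℝ^×` with
`(c · id) γ ∈ Hg(Hᵏ(X))(ℝ)`. [cite: GreenGriffithsKerr2012, §I.B p. 35 (semi-direct product remark)] [cite: CarlsonMullerStachPeters2017, §15.2 Examples 15.2.4] -/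
theorem existsUnique_smulOfUnit_mul_mem_hodgeGroupBaseChange_hodge_real_of_comm_of_neg_one_not_mem [Nontrivial (bettiCohomology X k)]
    (hHD : exists_isReal_hodgeModel) (hX : IsSmoothProjective n X) (ψ : (BettiUniverse.hodge hHD hX k).Polarization)
    (h1 : LinearEquiv.smulOfUnit (-1) ∉ (BettiUniverse.hodge hHD hX k).hodgeGroupBaseChange ℝ)
    {γ : (ℝ ⊗[ℚ] bettiCohomology X k) ≃ₗ[ℝ] (ℝ ⊗[ℚ] bettiCohomology X k)}
    (hγ : γ ∈ (BettiUniverse.hodge hHD hX k).mumfordTateGroupBaseChange ℝ)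
    (hC : ∀ a, γ ((BettiUniverse.hodge hHD hX k).realWeilOperator a) = (BettiUniverse.hodge hHD hX k).realWeilOperator (γ a)) :
    ∃! c : ℝˣ, LinearEquiv.smulOfUnit c * γ ∈ (BettiUniverse.hodge hHD hX k).hodgeGroupBaseChange ℝ :=
  ψ.existsUnique_smulOfUnit_mul_mem_hodgeGroupBaseChange_real_of_comm_of_neg_one_not_mem _ h1 hγ hC

end SmoothProjective

end Literature.AlgebraicGeometry.HodgeTheory

end
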